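import Summits.RiemannHypothesis.RiemannHypothesis.Theses.LeeYang
import Summits.RiemannHypothesis.RiemannHypothesis.Theorems.LeeYangLeeyangThesis
import Literature.NumberTheory.LFunctions.PolyaKernelRHProofs
import Literature.NumberTheory.LFunctions.DeBruijnHZeroProofs
import Literature.NumberTheory.LFunctions.DeBruijnNewmanProofs
import Literature.NumberTheory.LFunctions.RiemannXiHadamardProduct
import HarnessLib

/-!
# Stub `stub_dB` of line `Sketch` (card `telegraph-string`; crux `LeeYang.LeeyangThesis`,
item stmt-RiemannHypothesis-0451): identification of the de Bruijn law

Registered stub of the skeleton for `LeeyangThesis`: for the normalised de Bruijn law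
`ν = ν_Φ = Φ(u) du / ∫Φ` (`Φ = deBruijnPhi`, the Pólya–de Bruijn kernel),
* the two-sided Laplace transform is `∫ e^{hu} dν_Φ = ξ(1/2 + h/2) / ξ(1/2)` at every `h ∈ ℂ`
  (Pólya's representation `∫ e^{hu} Φ = 2 H₀(ih)` = `integral_exp_mul_deBruijnPhi`,
  `H₀(z) = ξ(1/2 + iz/2)/8` = `deBruijnH_zero_eq_holds`, the functional equation
  `riemannXi_one_sub`, and the normalising constant `∫ Φ = 2 H₀(0) = ξ(1/2)/4`, the case `h = 0`);
* every Gaussian moment `∫ e^{bu²} dν_Φ`, `b ∈ ℝ`, is finite (double-exponential decay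
  `Φ(u) ≤ C e^{9u - π e^{4u}}` for `u ≥ 0`, `deBruijnPhi_le_exp_holds`, plus evenness
  `deBruijnPhi_neg_holds`; the elementary bound `b u² + 9 u - π e^{4u} ≤ (|b|+10)²/(4π) - u²`
  reduces to the Gaussian `e^{-u²}`).
-/

set_option linter.dupNamespace false

noncomputable section

open MeasureTheory Filter Topology Complex
open scoped ENNReal

namespace Summit.RiemannHypothesis.RiemannHypothesis.Theorems.LeeYangTelegraphString

open Literature.Probability.LatticeModels Literature.NumberTheory.LFunctions
open Summit.RiemannHypothesis.LeeYang

/-- The normalising constant as a complex number: `((∫⁻ Φ).toReal : ℂ) = 2 H₀(0)` (the case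
`h = 0` of Pólya's representation `integral_exp_mul_deBruijnPhi`). [folklore] -/
theorem stub_dB_ofReal_toReal_lintegral :
    (((∫⁻ u, ENNReal.ofReal (deBruijnPhi u)).toReal : ℝ) : ℂ) = 2 * deBruijnH 0 0 := by
  have h1 : (∫⁻ u, ENNReal.ofReal (deBruijnPhi u)).toReal = ∫ u, deBruijnPhi u :=
    (integral_eq_lintegral_of_nonneg_ae
      (Filter.Eventually.of_forall fun u => (deBruijnPhi_pos_holds u).le)
      continuous_deBruijnPhi.aestronglyMeasurable).symm
  rw [h1, ← integral_complex_ofReal, ← mul_zero I, ← integral_exp_mul_deBruijnPhi 0]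
  refine integral_congr_ae (Filter.Eventually.of_forall fun u => ?_)
  simp

/-- The elementary exponent bound behind the Gaussian moments: for `u ≥ 0`,
`b u² + 9 u - π e^{4u} ≤ (|b| + 10)² / (4π) - u²` (from `u, u² ≤ e^{2u}` and AM–GM
`(|b|+10) x ≤ π x² + (|b|+10)²/(4π)` at `x = e^{2u}`). [folklore] -/
theorem stub_dB_exponent_le (b : ℝ) {u : ℝ} (hu : 0 ≤ u) :
    b * u ^ 2 + 9 * u - Real.pi * Real.exp (4 * u) ≤ (|b| + 10) ^ 2 / (4 * Real.pi) - u ^ 2 := by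
  set x := Real.exp (2 * u) with hx
  have hx4 : Real.exp (4 * u) = x ^ 2 := by
    rw [hx, ← Real.exp_nat_mul]; ring_nf
  have hux : u ≤ x := by
    have := Real.add_one_le_exp (2 * u)
    linarith
  have hu2x : u ^ 2 ≤ x := by
    have h1 := Real.add_one_le_exp u
    have h2 : u ^ 2 ≤ Real.exp u ^ 2 := pow_le_pow_left₀ hu (by linarith) 2
    calc u ^ 2 ≤ Real.exp u ^ 2 := h2
      _ = x := by rw [hx, ← Real.exp_nat_mul]; ring_nf
  have hb1 : (b + 1) * u ^ 2 ≤ (|b| + 1) * x := by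
    calc (b + 1) * u ^ 2 ≤ (|b| + 1) * u ^ 2 :=
          mul_le_mul_of_nonneg_right (by linarith [le_abs_self b]) (sq_nonneg u)
      _ ≤ (|b| + 1) * x := mul_le_mul_of_nonneg_left hu2x (by positivity)
  have hπ : 0 < Real.pi := Real.pi_pos
  have hamgm : (|b| + 10) * x ≤ Real.pi * x ^ 2 + (|b| + 10) ^ 2 / (4 * Real.pi) := by
    have h0 : 0 ≤ Real.pi * (x - (|b| + 10) / (2 * Real.pi)) ^ 2 := by positivity
    have h' : Real.pi * (x - (|b| + 10) / (2 * Real.pi)) ^ 2 =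
        Real.pi * x ^ 2 - (|b| + 10) * x + (|b| + 10) ^ 2 / (4 * Real.pi) := by
      field_simp
      ring
    linarith
  have hexp : (|b| + 10) * x = (|b| + 1) * x + 9 * x := by ring
  rw [hx4]
  linarith

/-- The pointwise majorant behind the Gaussian moments: with `C` the constant of
`deBruijnPhi_le_exp_holds`, `Φ(u) e^{bu²} ≤ C e^{(|b|+10)²/(4π)} e^{-u²}` for ALL real `u`
(evenness of `Φ`). [folklore] -/
theorem stub_dB_majorant (b : ℝ) {C : ℝ}
    (hC : ∀ u : ℝ, 0 ≤ u → deBruijnPhi u ≤ C * Real.exp (9 * u - Real.pi * Real.exp (4 * u)))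
    (u : ℝ) :
    deBruijnPhi u * Real.exp (b * u ^ 2) ≤
      C * Real.exp ((|b| + 10) ^ 2 / (4 * Real.pi)) * Real.exp (-1 * u ^ 2) := by
  -- the half-line `u ≥ 0`
  have hpos : ∀ v : ℝ, 0 ≤ v → deBruijnPhi v * Real.exp (b * v ^ 2) ≤
      C * Real.exp ((|b| + 10) ^ 2 / (4 * Real.pi)) * Real.exp (-1 * v ^ 2) := by
    intro v hv
    calc deBruijnPhi v * Real.exp (b * v ^ 2)
        ≤ C * Real.exp (9 * v - Real.pi * Real.exp (4 * v)) * Real.exp (b * v ^ 2) :=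
          mul_le_mul_of_nonneg_right (hC v hv) (Real.exp_pos _).le
      _ = C * Real.exp (b * v ^ 2 + 9 * v - Real.pi * Real.exp (4 * v)) := by
          rw [mul_assoc, ← Real.exp_add]; ring_nf
      _ ≤ C * Real.exp ((|b| + 10) ^ 2 / (4 * Real.pi) - v ^ 2) := by
          have hC0 : 0 ≤ C := by
            have h0 := hC 0 le_rfl
            have hp := deBruijnPhi_pos_holds 0
            have he : 0 < Real.exp (9 * 0 - Real.pi * Real.exp (4 * 0)) := Real.exp_pos _
            nlinarith
          exact mul_le_mul_of_nonneg_left (Real.exp_le_exp.2 (stub_dB_exponent_le b hv)) hC0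
      _ = C * Real.exp ((|b| + 10) ^ 2 / (4 * Real.pi)) * Real.exp (-1 * v ^ 2) := by
          rw [sub_eq_add_neg, Real.exp_add]; ring_nf
  rcases le_or_gt 0 u with hu | hu
  · exact hpos u hu
  · have := hpos (-u) (by linarith)
    rwa [deBruijnPhi_neg_holds u, neg_sq] at this

/-- **Stub dB — identification of the de Bruijn law.** For `ν = ν_Φ = Φ du/∫Φ`: the two-sided
Laplace transform is `ξ(1/2 + h/2)/ξ(1/2)` at every `h ∈ ℂ` (Pólya: `∫ e^{hu}Φ = 2H₀(ih)`,
`integral_exp_mul_deBruijnPhi`, `deBruijnH_zero_eq_holds`, `riemannXi_one_sub`; the normalising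
constant is the case `h = 0`), and `e^{bu²}` is `ν`-integrable for every real `b` (double-exponential
decay `deBruijnPhi_le_exp_holds` + evenness `deBruijnPhi_neg_holds`). [folklore] -/
theorem stub_dB : ∀ ν : ProbabilityMeasure ℝ,
    (ν : Measure ℝ) = (∫⁻ u, ENNReal.ofReal (deBruijnPhi u))⁻¹ •
      volume.withDensity (fun u => ENNReal.ofReal (deBruijnPhi u)) →
    (∀ h : ℂ, ∫ u, cexp (h * u) ∂(ν : Measure ℝ) = riemannXi (1 / 2 + h / 2) / riemannXi (1 / 2)) ∧
    ∀ b : ℝ, Integrable (fun u : ℝ => Real.exp (b * u ^ 2)) (ν : Measure ℝ) := by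
  intro ν hν
  refine ⟨fun h => ?_, fun b => ?_⟩
  · -- (a) the Laplace transform
    rw [integral_exp_mul_of_eq hν h, integral_exp_mul_deBruijnPhi h,
      deBruijnH_zero_eq_holds (I * h), Complex.real_smul, Complex.ofReal_inv,
      stub_dB_ofReal_toReal_lintegral, riemannXi_one_half_eq]
    have harg : 1 / 2 + I * (I * h) / 2 = 1 - (1 / 2 + h / 2) := by
      rw [← mul_assoc, Complex.I_mul_I]; ring
    rw [harg, riemannXi_one_sub]
    have hH : deBruijnH 0 0 ≠ 0 := by
      have h8 := riemannXi_one_half_ne_zero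
      rw [riemannXi_one_half_eq] at h8
      exact right_ne_zero_of_mul h8
    field_simp
  · -- (b) the Gaussian moments
    rw [hν, integrable_smul_measure (ENNReal.inv_ne_zero.2 lintegral_deBruijnPhi_ne_top)
        (ENNReal.inv_ne_top.2 lintegral_deBruijnPhi_ne_zero),
      integrable_withDensity_iff measurable_ofReal_deBruijnPhi
        (Filter.Eventually.of_forall fun _ => ENNReal.ofReal_lt_top)]
    have hfun : (fun u : ℝ => Real.exp (b * u ^ 2) * (ENNReal.ofReal (deBruijnPhi u)).toReal) =
        fun u => deBruijnPhi u * Real.exp (b * u ^ 2) := by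
      funext u
      rw [ENNReal.toReal_ofReal (deBruijnPhi_pos_holds u).le, mul_comm]
    rw [hfun]
    obtain ⟨C, hC⟩ := deBruijnPhi_le_exp_holds
    refine Integrable.mono'
      (g := fun u => C * Real.exp ((|b| + 10) ^ 2 / (4 * Real.pi)) * Real.exp (-1 * u ^ 2))
      ((integrable_exp_neg_mul_sq one_pos).const_mul _)
      (continuous_deBruijnPhi.mul (by fun_prop)).aestronglyMeasurable
      (Filter.Eventually.of_forall fun u => ?_)
    rw [Real.norm_eq_abs,
      abs_of_nonneg (mul_nonneg (deBruijnPhi_pos_holds u).le (Real.exp_pos _).le)]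
    exact stub_dB_majorant b hC u

end Summit.RiemannHypothesis.RiemannHypothesis.Theorems.LeeYangTelegraphString

end
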